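import Mathlib
import Summits.NavierStokesRegularity.NavierStokesRegularity.Theses.TypeIIInviscidRelaxation
import Literature.Analysis.FluidPDE.TypeIICoreWitness
import HarnessLib

/-!
# Cruxes `ColumnarCoreExclusion` (stmt-1966) / `MonopoleCoreExclusion` (stmt-1965): the level quantifier of the
# shadowing stubs COLLAPSES — each registered [XL] stub is equivalent to its single-level form

`--supports stmt-NavierStokesRegularity-1966` (helper file; theorems only, no definitions, no `sorry`; the axisymmetric
half serves stmt-1965 verbatim).

The registered shadowing stubs `stub_columnarShadowing` (line `columnar_comparison_flow`, skeleton `812bbbce6ea9853a`)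
and `stub_axisymShadowing` (line `axisymmetric_comparison_flow`, skeleton `dd3458b3c2b350bd`) have the quantifier shape
`∀ A > 0, ∃ K₀ ≥ 1, ∀ K ≥ K₀, P_A(K)`, where `P_A(K)` is the level-`K` statement «core normalisation at time `t`
(`‖u(t)‖ ≤ V`, near-maximum within `L` of `x₀`), core Reynolds number `K ≤ LV/ν`, horizon `(T - t)V ≤ KL`, a bounded
exactly columnar (resp. axisymmetric) classical comparison flow `A·V/K`-close on `B(x₀, KL/2)` (resp. `B(x₀, KL)`)
⟹ `u` bounded on `[t,T) × B(x₀, 3KL/8)` (resp. `× B(x₀, KL/2)`)».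

This file proves, by the core-length rescaling `L ↦ (K/K')·L` (centre, frame, speed bound and comparison flow
unchanged), that the level statement is MONOTONE:

* `columnarShadowing_level_mono`, `axisymShadowing_level_mono` — `P_A(K') → P_A(K)` whenever `0 < K' ≤ K` (and
  `0 ≤ A`): a level-`K` configuration with core length `L` is a level-`K'` configuration with core length `KL/K' ≥ L`
  (same balls `K'·(KL/K') = KL`, Reynolds `K'ν ≤ K²ν/K' ≤ (KL/K')V`, closeness `A V/K ≤ A V/K'`).
* `columnarShadowing_closeness_antitone`, `axisymShadowing_closeness_antitone` — `P_A(K) → P_{A'}(K)` for `A' ≤ A`.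
* `columnarShadowing_iff_singleLevel`, `axisymShadowing_iff_singleLevel` — each REGISTERED stub (statement verbatim,
  left) is equivalent to `∀ A > 0, ∃ K ≥ 1, P_A(K)`: the clause `∀ K ≥ K₀` is logically idle (the compositions
  `ColumnarCoreExclusion_of` / `MonopoleCoreExclusion_of` indeed use only `K = K₀`).
* since closeness budgets are antitone, integer budgets suffice: the stub is the countable family
  `∀ n : ℕ, ∃ K ≥ 1, P_{n+1}(K)` (immediate from the two lemmas above; not spelled out).

Honest framing.  Pure quantifier bookkeeping on the registered signatures (no dynamics is used); it tells a line-writer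
that the research content of either stub is «for every closeness budget `A` there is ONE level `K` at which a late,
`A·V/K`-near-columnar (resp. near-axisymmetric) core does not blow up locally within `K` turnovers», and nothing more.
No stub is closed by name; nothing about Navier–Stokes regularity is claimed; rung 0.
-/

open Set Metric
open Literature.Analysis Literature.Analysis.FluidPDE

namespace Summit.NavierStokesRegularity.NavierStokesRegularity.Theorems

-- the problem directory repeats the summit name (`NavierStokesRegularity/NavierStokesRegularity`)
set_option linter.dupNamespace false

namespace CoreExclusionShadowing

/-! ## Columnar class (`stub_columnarShadowing`, stmt-1966) -/

/-- **Level monotonicity, columnar class.**  For `0 ≤ A` and levels `0 < K' ≤ K`, the level-`K'` shadowing statement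
implies the level-`K` one: feed the level-`K'` statement with the rescaled core length `K·L/K'` (same centre, frame,
speed bound, horizon and comparison flow); the balls `K'·(KL/K')/2 = KL/2`, `3K'(KL/K')/8 = 3KL/8` coincide, the
Reynolds hypothesis follows from `K'² ≤ K²`, and the closeness `A·V/K ≤ A·V/K'`. [folklore] -/
theorem columnarShadowing_level_mono {A K' K : ℝ} (hA : 0 ≤ A) (hK' : 0 < K') (hK'K : K' ≤ K)
    (h : ∀ (ν T t : ℝ) (u : ℝ → EuclideanSpace ℝ (Fin 3) → EuclideanSpace ℝ (Fin 3))
        (p : ℝ → EuclideanSpace ℝ (Fin 3) → ℝ),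
        0 < ν → 0 < T → IsClassicalNSSolutionOn (Ico 0 T) ν 0 u p → IsLerayHopfOn T ν 0 (u 0) u →
        HasRapidSpatialDecay (u 0) → 0 < t → t < T →
        ∀ (x₀ : EuclideanSpace ℝ (Fin 3)) (L V : ℝ)
          (Q : EuclideanSpace ℝ (Fin 3) ≃ₗᵢ[ℝ] EuclideanSpace ℝ (Fin 3)),
          0 < L → 0 < V → (∀ x, ‖u t x‖ ≤ V) →
          (∃ x₁, dist x₁ x₀ ≤ L ∧ V ≤ 2 * ‖u t x₁‖) → K' * ν ≤ L * V → (T - t) * V ≤ K' * L →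
          ∀ (v : ℝ → EuclideanSpace ℝ (Fin 3) → EuclideanSpace ℝ (Fin 3))
            (q : ℝ → EuclideanSpace ℝ (Fin 3) → ℝ) (Mv : ℝ),
            IsClassicalNSSolutionOn (Icc t T) ν 0 v q →
            (∀ s ∈ Icc t T, ∀ (x : EuclideanSpace ℝ (Fin 3)) (τ : ℝ), v s (x + τ • Q eZ) = v s x) →
            (∀ s ∈ Icc t T, ∀ x, ‖v s x‖ ≤ Mv) →
            (∀ x ∈ ball x₀ (K' * L / 2), ‖u t x - v t x‖ ≤ A * V / K') →
            ∃ M : ℝ, ∀ s ∈ Ico t T, ∀ x ∈ ball x₀ (3 * K' * L / 8), ‖u s x‖ ≤ M) :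
    ∀ (ν T t : ℝ) (u : ℝ → EuclideanSpace ℝ (Fin 3) → EuclideanSpace ℝ (Fin 3))
        (p : ℝ → EuclideanSpace ℝ (Fin 3) → ℝ),
        0 < ν → 0 < T → IsClassicalNSSolutionOn (Ico 0 T) ν 0 u p → IsLerayHopfOn T ν 0 (u 0) u →
        HasRapidSpatialDecay (u 0) → 0 < t → t < T →
        ∀ (x₀ : EuclideanSpace ℝ (Fin 3)) (L V : ℝ)
          (Q : EuclideanSpace ℝ (Fin 3) ≃ₗᵢ[ℝ] EuclideanSpace ℝ (Fin 3)),
          0 < L → 0 < V → (∀ x, ‖u t x‖ ≤ V) →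
          (∃ x₁, dist x₁ x₀ ≤ L ∧ V ≤ 2 * ‖u t x₁‖) → K * ν ≤ L * V → (T - t) * V ≤ K * L →
          ∀ (v : ℝ → EuclideanSpace ℝ (Fin 3) → EuclideanSpace ℝ (Fin 3))
            (q : ℝ → EuclideanSpace ℝ (Fin 3) → ℝ) (Mv : ℝ),
            IsClassicalNSSolutionOn (Icc t T) ν 0 v q →
            (∀ s ∈ Icc t T, ∀ (x : EuclideanSpace ℝ (Fin 3)) (τ : ℝ), v s (x + τ • Q eZ) = v s x) →
            (∀ s ∈ Icc t T, ∀ x, ‖v s x‖ ≤ Mv) →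
            (∀ x ∈ ball x₀ (K * L / 2), ‖u t x - v t x‖ ≤ A * V / K) →
            ∃ M : ℝ, ∀ s ∈ Ico t T, ∀ x ∈ ball x₀ (3 * K * L / 8), ‖u s x‖ ≤ M := by
  intro ν T t u p hν hT hcl hLH hdec ht htT x₀ L V Q hL hV hbd hnear hRe hlate v q Mv hv hvcol hvbd hclose
  have hK : 0 < K := lt_of_lt_of_le hK' hK'K
  have hK'0 : K' ≠ 0 := hK'.ne'
  -- the rescaled core length `K L / K'` and its bookkeeping
  have hL'pos : 0 < K * L / K' := by positivity
  have hKL : K' * (K * L / K') = K * L := by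
    rw [← mul_div_assoc, mul_div_cancel_left₀ _ hK'0]
  have hLL' : L ≤ K * L / K' := by
    rw [le_div_iff₀ hK']
    calc L * K' ≤ L * K := mul_le_mul_of_nonneg_left hK'K hL.le
      _ = K * L := mul_comm _ _
  have hnear' : ∃ x₁, dist x₁ x₀ ≤ K * L / K' ∧ V ≤ 2 * ‖u t x₁‖ := by
    obtain ⟨x₁, hx₁, hVx₁⟩ := hnear
    exact ⟨x₁, hx₁.trans hLL', hVx₁⟩
  have hRe' : K' * ν ≤ K * L / K' * V := by
    rw [div_mul_eq_mul_div, le_div_iff₀ hK']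
    have hKK : K' * K' ≤ K * K := mul_le_mul hK'K hK'K hK'.le hK.le
    calc K' * ν * K' = K' * K' * ν := by ring
      _ ≤ K * K * ν := mul_le_mul_of_nonneg_right hKK hν.le
      _ = K * (K * ν) := by ring
      _ ≤ K * (L * V) := mul_le_mul_of_nonneg_left hRe hK.le
      _ = K * L * V := by ring
  have hlate' : (T - t) * V ≤ K' * (K * L / K') := by
    rw [hKL]
    exact hlate
  have hclose' : ∀ x ∈ ball x₀ (K' * (K * L / K') / 2), ‖u t x - v t x‖ ≤ A * V / K' := by
    intro x hx
    rw [hKL] at hx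
    calc ‖u t x - v t x‖ ≤ A * V / K := hclose x hx
      _ ≤ A * V / K' := div_le_div_of_nonneg_left (mul_nonneg hA hV.le) hK' hK'K
  obtain ⟨M, hM⟩ := h ν T t u p hν hT hcl hLH hdec ht htT x₀ (K * L / K') V Q hL'pos hV hbd hnear' hRe'
    hlate' v q Mv hv hvcol hvbd hclose'
  have h38 : 3 * K' * (K * L / K') / 8 = 3 * K * L / 8 := by
    rw [show 3 * K' * (K * L / K') = 3 * (K' * (K * L / K')) by ring, hKL]
    ring
  refine ⟨M, fun s hs x hx => hM s hs x ?_⟩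
  rwa [h38]

/-- **Closeness antitonicity, columnar class.**  For `A' ≤ A` (and `0 < K`), the level-`K` statement with closeness
budget `A` implies the one with budget `A'`: the hypothesis `‖u(t) - v(t)‖ ≤ A'·V/K` is stronger. [folklore] -/
theorem columnarShadowing_closeness_antitone {A A' K : ℝ} (hAA' : A' ≤ A) (hK : 0 < K)
    (h : ∀ (ν T t : ℝ) (u : ℝ → EuclideanSpace ℝ (Fin 3) → EuclideanSpace ℝ (Fin 3))
        (p : ℝ → EuclideanSpace ℝ (Fin 3) → ℝ),
        0 < ν → 0 < T → IsClassicalNSSolutionOn (Ico 0 T) ν 0 u p → IsLerayHopfOn T ν 0 (u 0) u →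
        HasRapidSpatialDecay (u 0) → 0 < t → t < T →
        ∀ (x₀ : EuclideanSpace ℝ (Fin 3)) (L V : ℝ)
          (Q : EuclideanSpace ℝ (Fin 3) ≃ₗᵢ[ℝ] EuclideanSpace ℝ (Fin 3)),
          0 < L → 0 < V → (∀ x, ‖u t x‖ ≤ V) →
          (∃ x₁, dist x₁ x₀ ≤ L ∧ V ≤ 2 * ‖u t x₁‖) → K * ν ≤ L * V → (T - t) * V ≤ K * L →
          ∀ (v : ℝ → EuclideanSpace ℝ (Fin 3) → EuclideanSpace ℝ (Fin 3))
            (q : ℝ → EuclideanSpace ℝ (Fin 3) → ℝ) (Mv : ℝ),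
            IsClassicalNSSolutionOn (Icc t T) ν 0 v q →
            (∀ s ∈ Icc t T, ∀ (x : EuclideanSpace ℝ (Fin 3)) (τ : ℝ), v s (x + τ • Q eZ) = v s x) →
            (∀ s ∈ Icc t T, ∀ x, ‖v s x‖ ≤ Mv) →
            (∀ x ∈ ball x₀ (K * L / 2), ‖u t x - v t x‖ ≤ A * V / K) →
            ∃ M : ℝ, ∀ s ∈ Ico t T, ∀ x ∈ ball x₀ (3 * K * L / 8), ‖u s x‖ ≤ M) :
    ∀ (ν T t : ℝ) (u : ℝ → EuclideanSpace ℝ (Fin 3) → EuclideanSpace ℝ (Fin 3))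
        (p : ℝ → EuclideanSpace ℝ (Fin 3) → ℝ),
        0 < ν → 0 < T → IsClassicalNSSolutionOn (Ico 0 T) ν 0 u p → IsLerayHopfOn T ν 0 (u 0) u →
        HasRapidSpatialDecay (u 0) → 0 < t → t < T →
        ∀ (x₀ : EuclideanSpace ℝ (Fin 3)) (L V : ℝ)
          (Q : EuclideanSpace ℝ (Fin 3) ≃ₗᵢ[ℝ] EuclideanSpace ℝ (Fin 3)),
          0 < L → 0 < V → (∀ x, ‖u t x‖ ≤ V) →
          (∃ x₁, dist x₁ x₀ ≤ L ∧ V ≤ 2 * ‖u t x₁‖) → K * ν ≤ L * V → (T - t) * V ≤ K * L →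
          ∀ (v : ℝ → EuclideanSpace ℝ (Fin 3) → EuclideanSpace ℝ (Fin 3))
            (q : ℝ → EuclideanSpace ℝ (Fin 3) → ℝ) (Mv : ℝ),
            IsClassicalNSSolutionOn (Icc t T) ν 0 v q →
            (∀ s ∈ Icc t T, ∀ (x : EuclideanSpace ℝ (Fin 3)) (τ : ℝ), v s (x + τ • Q eZ) = v s x) →
            (∀ s ∈ Icc t T, ∀ x, ‖v s x‖ ≤ Mv) →
            (∀ x ∈ ball x₀ (K * L / 2), ‖u t x - v t x‖ ≤ A' * V / K) →
            ∃ M : ℝ, ∀ s ∈ Ico t T, ∀ x ∈ ball x₀ (3 * K * L / 8), ‖u s x‖ ≤ M := by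
  intro ν T t u p hν hT hcl hLH hdec ht htT x₀ L V Q hL hV hbd hnear hRe hlate v q Mv hv hvcol hvbd hclose
  refine h ν T t u p hν hT hcl hLH hdec ht htT x₀ L V Q hL hV hbd hnear hRe hlate v q Mv hv hvcol hvbd ?_
  intro x hx
  calc ‖u t x - v t x‖ ≤ A' * V / K := hclose x hx
    _ ≤ A * V / K := by
      apply div_le_div_of_nonneg_right _ hK.le
      exact mul_le_mul_of_nonneg_right hAA' hV.le

/-- **Single-level form of `stub_columnarShadowing`.**  The REGISTERED stub (left, statement verbatim from
`Cruxes/ColumnarCoreExclusion/Lines/columnar_comparison_flow.lean`) is equivalent to its single-level form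
`∀ A > 0, ∃ K ≥ 1, P_A(K)` (right): `→` instantiates `K = K₀`; `←` is `columnarShadowing_level_mono`.  The clause
`∀ K ≥ K₀` of the registered signature is logically idle. [folklore] -/
theorem columnarShadowing_iff_singleLevel :
    (∀ A : ℝ, 0 < A → ∃ K₀ : ℝ, 1 ≤ K₀ ∧ ∀ K : ℝ, K₀ ≤ K →
      ∀ (ν T t : ℝ) (u : ℝ → EuclideanSpace ℝ (Fin 3) → EuclideanSpace ℝ (Fin 3))
        (p : ℝ → EuclideanSpace ℝ (Fin 3) → ℝ),
        0 < ν → 0 < T → IsClassicalNSSolutionOn (Ico 0 T) ν 0 u p → IsLerayHopfOn T ν 0 (u 0) u →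
        HasRapidSpatialDecay (u 0) → 0 < t → t < T →
        ∀ (x₀ : EuclideanSpace ℝ (Fin 3)) (L V : ℝ)
          (Q : EuclideanSpace ℝ (Fin 3) ≃ₗᵢ[ℝ] EuclideanSpace ℝ (Fin 3)),
          0 < L → 0 < V → (∀ x, ‖u t x‖ ≤ V) →
          (∃ x₁, dist x₁ x₀ ≤ L ∧ V ≤ 2 * ‖u t x₁‖) → K * ν ≤ L * V → (T - t) * V ≤ K * L →
          ∀ (v : ℝ → EuclideanSpace ℝ (Fin 3) → EuclideanSpace ℝ (Fin 3))
            (q : ℝ → EuclideanSpace ℝ (Fin 3) → ℝ) (Mv : ℝ),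
            IsClassicalNSSolutionOn (Icc t T) ν 0 v q →
            (∀ s ∈ Icc t T, ∀ (x : EuclideanSpace ℝ (Fin 3)) (τ : ℝ), v s (x + τ • Q eZ) = v s x) →
            (∀ s ∈ Icc t T, ∀ x, ‖v s x‖ ≤ Mv) →
            (∀ x ∈ ball x₀ (K * L / 2), ‖u t x - v t x‖ ≤ A * V / K) →
            ∃ M : ℝ, ∀ s ∈ Ico t T, ∀ x ∈ ball x₀ (3 * K * L / 8), ‖u s x‖ ≤ M) ↔
    (∀ A : ℝ, 0 < A → ∃ K : ℝ, 1 ≤ K ∧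
      ∀ (ν T t : ℝ) (u : ℝ → EuclideanSpace ℝ (Fin 3) → EuclideanSpace ℝ (Fin 3))
        (p : ℝ → EuclideanSpace ℝ (Fin 3) → ℝ),
        0 < ν → 0 < T → IsClassicalNSSolutionOn (Ico 0 T) ν 0 u p → IsLerayHopfOn T ν 0 (u 0) u →
        HasRapidSpatialDecay (u 0) → 0 < t → t < T →
        ∀ (x₀ : EuclideanSpace ℝ (Fin 3)) (L V : ℝ)
          (Q : EuclideanSpace ℝ (Fin 3) ≃ₗᵢ[ℝ] EuclideanSpace ℝ (Fin 3)),
          0 < L → 0 < V → (∀ x, ‖u t x‖ ≤ V) →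
          (∃ x₁, dist x₁ x₀ ≤ L ∧ V ≤ 2 * ‖u t x₁‖) → K * ν ≤ L * V → (T - t) * V ≤ K * L →
          ∀ (v : ℝ → EuclideanSpace ℝ (Fin 3) → EuclideanSpace ℝ (Fin 3))
            (q : ℝ → EuclideanSpace ℝ (Fin 3) → ℝ) (Mv : ℝ),
            IsClassicalNSSolutionOn (Icc t T) ν 0 v q →
            (∀ s ∈ Icc t T, ∀ (x : EuclideanSpace ℝ (Fin 3)) (τ : ℝ), v s (x + τ • Q eZ) = v s x) →
            (∀ s ∈ Icc t T, ∀ x, ‖v s x‖ ≤ Mv) →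
            (∀ x ∈ ball x₀ (K * L / 2), ‖u t x - v t x‖ ≤ A * V / K) →
            ∃ M : ℝ, ∀ s ∈ Ico t T, ∀ x ∈ ball x₀ (3 * K * L / 8), ‖u s x‖ ≤ M) := by
  constructor
  · intro h A hA
    obtain ⟨K₀, hK₀, hK⟩ := h A hA
    exact ⟨K₀, hK₀, hK K₀ le_rfl⟩
  · intro h A hA
    obtain ⟨K₀, hK₀, hK⟩ := h A hA
    exact ⟨K₀, hK₀, fun K hKK =>
      columnarShadowing_level_mono hA.le (lt_of_lt_of_le one_pos hK₀) hKK hK⟩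

/-! ## Axisymmetric class (`stub_axisymShadowing`, stmt-1965) -/

/-- **Level monotonicity, axisymmetric class.**  For `0 ≤ A` and levels `0 < K' ≤ K`, the level-`K'` axisymmetric
shadowing statement implies the level-`K` one, by the same core-length rescaling `L ↦ KL/K'` (the axis
`x₀ + ℝ·Q e_z` and the comparison flow are unchanged; balls `K'(KL/K') = KL` and `K'(KL/K')/2 = KL/2`). [folklore] -/
theorem axisymShadowing_level_mono {A K' K : ℝ} (hA : 0 ≤ A) (hK' : 0 < K') (hK'K : K' ≤ K)
    (h : ∀ (ν T t : ℝ) (u : ℝ → EuclideanSpace ℝ (Fin 3) → EuclideanSpace ℝ (Fin 3))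
        (p : ℝ → EuclideanSpace ℝ (Fin 3) → ℝ),
        0 < ν → 0 < T → IsClassicalNSSolutionOn (Ico 0 T) ν 0 u p → IsLerayHopfOn T ν 0 (u 0) u →
        HasRapidSpatialDecay (u 0) → 0 < t → t < T →
        ∀ (x₀ : EuclideanSpace ℝ (Fin 3)) (L V : ℝ)
          (Q : EuclideanSpace ℝ (Fin 3) ≃ₗᵢ[ℝ] EuclideanSpace ℝ (Fin 3)),
          0 < L → 0 < V → (∀ x, ‖u t x‖ ≤ V) →
          (∃ x₁, dist x₁ x₀ ≤ L ∧ V ≤ 2 * ‖u t x₁‖) → K' * ν ≤ L * V → (T - t) * V ≤ K' * L →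
          ∀ (v : ℝ → EuclideanSpace ℝ (Fin 3) → EuclideanSpace ℝ (Fin 3))
            (q : ℝ → EuclideanSpace ℝ (Fin 3) → ℝ) (Mv : ℝ),
            IsClassicalNSSolutionOn (Icc t T) ν 0 v q →
            (∀ s ∈ Icc t T, IsAxisymmetric (fun y : EuclideanSpace ℝ (Fin 3) => Q.symm (v s (x₀ + Q y)))) →
            (∀ s ∈ Icc t T, ∀ x, ‖v s x‖ ≤ Mv) →
            (∀ x ∈ ball x₀ (K' * L), ‖u t x - v t x‖ ≤ A * V / K') →
            ∃ M : ℝ, ∀ s ∈ Ico t T, ∀ x ∈ ball x₀ (K' * L / 2), ‖u s x‖ ≤ M) :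
    ∀ (ν T t : ℝ) (u : ℝ → EuclideanSpace ℝ (Fin 3) → EuclideanSpace ℝ (Fin 3))
        (p : ℝ → EuclideanSpace ℝ (Fin 3) → ℝ),
        0 < ν → 0 < T → IsClassicalNSSolutionOn (Ico 0 T) ν 0 u p → IsLerayHopfOn T ν 0 (u 0) u →
        HasRapidSpatialDecay (u 0) → 0 < t → t < T →
        ∀ (x₀ : EuclideanSpace ℝ (Fin 3)) (L V : ℝ)
          (Q : EuclideanSpace ℝ (Fin 3) ≃ₗᵢ[ℝ] EuclideanSpace ℝ (Fin 3)),
          0 < L → 0 < V → (∀ x, ‖u t x‖ ≤ V) →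
          (∃ x₁, dist x₁ x₀ ≤ L ∧ V ≤ 2 * ‖u t x₁‖) → K * ν ≤ L * V → (T - t) * V ≤ K * L →
          ∀ (v : ℝ → EuclideanSpace ℝ (Fin 3) → EuclideanSpace ℝ (Fin 3))
            (q : ℝ → EuclideanSpace ℝ (Fin 3) → ℝ) (Mv : ℝ),
            IsClassicalNSSolutionOn (Icc t T) ν 0 v q →
            (∀ s ∈ Icc t T, IsAxisymmetric (fun y : EuclideanSpace ℝ (Fin 3) => Q.symm (v s (x₀ + Q y)))) →
            (∀ s ∈ Icc t T, ∀ x, ‖v s x‖ ≤ Mv) →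
            (∀ x ∈ ball x₀ (K * L), ‖u t x - v t x‖ ≤ A * V / K) →
            ∃ M : ℝ, ∀ s ∈ Ico t T, ∀ x ∈ ball x₀ (K * L / 2), ‖u s x‖ ≤ M := by
  intro ν T t u p hν hT hcl hLH hdec ht htT x₀ L V Q hL hV hbd hnear hRe hlate v q Mv hv hvax hvbd hclose
  have hK : 0 < K := lt_of_lt_of_le hK' hK'K
  have hK'0 : K' ≠ 0 := hK'.ne'
  have hL'pos : 0 < K * L / K' := by positivity
  have hKL : K' * (K * L / K') = K * L := by
    rw [← mul_div_assoc, mul_div_cancel_left₀ _ hK'0]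
  have hLL' : L ≤ K * L / K' := by
    rw [le_div_iff₀ hK']
    calc L * K' ≤ L * K := mul_le_mul_of_nonneg_left hK'K hL.le
      _ = K * L := mul_comm _ _
  have hnear' : ∃ x₁, dist x₁ x₀ ≤ K * L / K' ∧ V ≤ 2 * ‖u t x₁‖ := by
    obtain ⟨x₁, hx₁, hVx₁⟩ := hnear
    exact ⟨x₁, hx₁.trans hLL', hVx₁⟩
  have hRe' : K' * ν ≤ K * L / K' * V := by
    rw [div_mul_eq_mul_div, le_div_iff₀ hK']
    have hKK : K' * K' ≤ K * K := mul_le_mul hK'K hK'K hK'.le hK.le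
    calc K' * ν * K' = K' * K' * ν := by ring
      _ ≤ K * K * ν := mul_le_mul_of_nonneg_right hKK hν.le
      _ = K * (K * ν) := by ring
      _ ≤ K * (L * V) := mul_le_mul_of_nonneg_left hRe hK.le
      _ = K * L * V := by ring
  have hlate' : (T - t) * V ≤ K' * (K * L / K') := by
    rw [hKL]
    exact hlate
  have hclose' : ∀ x ∈ ball x₀ (K' * (K * L / K')), ‖u t x - v t x‖ ≤ A * V / K' := by
    intro x hx
    rw [hKL] at hx
    calc ‖u t x - v t x‖ ≤ A * V / K := hclose x hx
      _ ≤ A * V / K' := div_le_div_of_nonneg_left (mul_nonneg hA hV.le) hK' hK'K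
  obtain ⟨M, hM⟩ := h ν T t u p hν hT hcl hLH hdec ht htT x₀ (K * L / K') V Q hL'pos hV hbd hnear' hRe'
    hlate' v q Mv hv hvax hvbd hclose'
  have h2 : K' * (K * L / K') / 2 = K * L / 2 := by rw [hKL]
  refine ⟨M, fun s hs x hx => hM s hs x ?_⟩
  rwa [h2]

/-- **Closeness antitonicity, axisymmetric class.**  For `A' ≤ A` (and `0 < K`), the level-`K` axisymmetric
statement with closeness budget `A` implies the one with budget `A'`. [folklore] -/
theorem axisymShadowing_closeness_antitone {A A' K : ℝ} (hAA' : A' ≤ A) (hK : 0 < K)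
    (h : ∀ (ν T t : ℝ) (u : ℝ → EuclideanSpace ℝ (Fin 3) → EuclideanSpace ℝ (Fin 3))
        (p : ℝ → EuclideanSpace ℝ (Fin 3) → ℝ),
        0 < ν → 0 < T → IsClassicalNSSolutionOn (Ico 0 T) ν 0 u p → IsLerayHopfOn T ν 0 (u 0) u →
        HasRapidSpatialDecay (u 0) → 0 < t → t < T →
        ∀ (x₀ : EuclideanSpace ℝ (Fin 3)) (L V : ℝ)
          (Q : EuclideanSpace ℝ (Fin 3) ≃ₗᵢ[ℝ] EuclideanSpace ℝ (Fin 3)),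
          0 < L → 0 < V → (∀ x, ‖u t x‖ ≤ V) →
          (∃ x₁, dist x₁ x₀ ≤ L ∧ V ≤ 2 * ‖u t x₁‖) → K * ν ≤ L * V → (T - t) * V ≤ K * L →
          ∀ (v : ℝ → EuclideanSpace ℝ (Fin 3) → EuclideanSpace ℝ (Fin 3))
            (q : ℝ → EuclideanSpace ℝ (Fin 3) → ℝ) (Mv : ℝ),
            IsClassicalNSSolutionOn (Icc t T) ν 0 v q →
            (∀ s ∈ Icc t T, IsAxisymmetric (fun y : EuclideanSpace ℝ (Fin 3) => Q.symm (v s (x₀ + Q y)))) →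
            (∀ s ∈ Icc t T, ∀ x, ‖v s x‖ ≤ Mv) →
            (∀ x ∈ ball x₀ (K * L), ‖u t x - v t x‖ ≤ A * V / K) →
            ∃ M : ℝ, ∀ s ∈ Ico t T, ∀ x ∈ ball x₀ (K * L / 2), ‖u s x‖ ≤ M) :
    ∀ (ν T t : ℝ) (u : ℝ → EuclideanSpace ℝ (Fin 3) → EuclideanSpace ℝ (Fin 3))
        (p : ℝ → EuclideanSpace ℝ (Fin 3) → ℝ),
        0 < ν → 0 < T → IsClassicalNSSolutionOn (Ico 0 T) ν 0 u p → IsLerayHopfOn T ν 0 (u 0) u →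
        HasRapidSpatialDecay (u 0) → 0 < t → t < T →
        ∀ (x₀ : EuclideanSpace ℝ (Fin 3)) (L V : ℝ)
          (Q : EuclideanSpace ℝ (Fin 3) ≃ₗᵢ[ℝ] EuclideanSpace ℝ (Fin 3)),
          0 < L → 0 < V → (∀ x, ‖u t x‖ ≤ V) →
          (∃ x₁, dist x₁ x₀ ≤ L ∧ V ≤ 2 * ‖u t x₁‖) → K * ν ≤ L * V → (T - t) * V ≤ K * L →
          ∀ (v : ℝ → EuclideanSpace ℝ (Fin 3) → EuclideanSpace ℝ (Fin 3))
            (q : ℝ → EuclideanSpace ℝ (Fin 3) → ℝ) (Mv : ℝ),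
            IsClassicalNSSolutionOn (Icc t T) ν 0 v q →
            (∀ s ∈ Icc t T, IsAxisymmetric (fun y : EuclideanSpace ℝ (Fin 3) => Q.symm (v s (x₀ + Q y)))) →
            (∀ s ∈ Icc t T, ∀ x, ‖v s x‖ ≤ Mv) →
            (∀ x ∈ ball x₀ (K * L), ‖u t x - v t x‖ ≤ A' * V / K) →
            ∃ M : ℝ, ∀ s ∈ Ico t T, ∀ x ∈ ball x₀ (K * L / 2), ‖u s x‖ ≤ M := by
  intro ν T t u p hν hT hcl hLH hdec ht htT x₀ L V Q hL hV hbd hnear hRe hlate v q Mv hv hvax hvbd hclose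
  refine h ν T t u p hν hT hcl hLH hdec ht htT x₀ L V Q hL hV hbd hnear hRe hlate v q Mv hv hvax hvbd ?_
  intro x hx
  calc ‖u t x - v t x‖ ≤ A' * V / K := hclose x hx
    _ ≤ A * V / K := by
      apply div_le_div_of_nonneg_right _ hK.le
      exact mul_le_mul_of_nonneg_right hAA' hV.le

/-- **Single-level form of `stub_axisymShadowing`.**  The REGISTERED stub (left, statement verbatim from
`Cruxes/MonopoleCoreExclusion/Lines/axisymmetric_comparison_flow.lean`) is equivalent to its single-level form
`∀ A > 0, ∃ K ≥ 1, P_A(K)` (right); the clause `∀ K ≥ K₀` is logically idle. [folklore] -/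
theorem axisymShadowing_iff_singleLevel :
    (∀ A : ℝ, 0 < A → ∃ K₀ : ℝ, 1 ≤ K₀ ∧ ∀ K : ℝ, K₀ ≤ K →
      ∀ (ν T t : ℝ) (u : ℝ → EuclideanSpace ℝ (Fin 3) → EuclideanSpace ℝ (Fin 3))
        (p : ℝ → EuclideanSpace ℝ (Fin 3) → ℝ),
        0 < ν → 0 < T → IsClassicalNSSolutionOn (Ico 0 T) ν 0 u p → IsLerayHopfOn T ν 0 (u 0) u →
        HasRapidSpatialDecay (u 0) → 0 < t → t < T →
        ∀ (x₀ : EuclideanSpace ℝ (Fin 3)) (L V : ℝ)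
          (Q : EuclideanSpace ℝ (Fin 3) ≃ₗᵢ[ℝ] EuclideanSpace ℝ (Fin 3)),
          0 < L → 0 < V → (∀ x, ‖u t x‖ ≤ V) →
          (∃ x₁, dist x₁ x₀ ≤ L ∧ V ≤ 2 * ‖u t x₁‖) → K * ν ≤ L * V → (T - t) * V ≤ K * L →
          ∀ (v : ℝ → EuclideanSpace ℝ (Fin 3) → EuclideanSpace ℝ (Fin 3))
            (q : ℝ → EuclideanSpace ℝ (Fin 3) → ℝ) (Mv : ℝ),
            IsClassicalNSSolutionOn (Icc t T) ν 0 v q →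
            (∀ s ∈ Icc t T, IsAxisymmetric (fun y : EuclideanSpace ℝ (Fin 3) => Q.symm (v s (x₀ + Q y)))) →
            (∀ s ∈ Icc t T, ∀ x, ‖v s x‖ ≤ Mv) →
            (∀ x ∈ ball x₀ (K * L), ‖u t x - v t x‖ ≤ A * V / K) →
            ∃ M : ℝ, ∀ s ∈ Ico t T, ∀ x ∈ ball x₀ (K * L / 2), ‖u s x‖ ≤ M) ↔
    (∀ A : ℝ, 0 < A → ∃ K : ℝ, 1 ≤ K ∧
      ∀ (ν T t : ℝ) (u : ℝ → EuclideanSpace ℝ (Fin 3) → EuclideanSpace ℝ (Fin 3))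
        (p : ℝ → EuclideanSpace ℝ (Fin 3) → ℝ),
        0 < ν → 0 < T → IsClassicalNSSolutionOn (Ico 0 T) ν 0 u p → IsLerayHopfOn T ν 0 (u 0) u →
        HasRapidSpatialDecay (u 0) → 0 < t → t < T →
        ∀ (x₀ : EuclideanSpace ℝ (Fin 3)) (L V : ℝ)
          (Q : EuclideanSpace ℝ (Fin 3) ≃ₗᵢ[ℝ] EuclideanSpace ℝ (Fin 3)),
          0 < L → 0 < V → (∀ x, ‖u t x‖ ≤ V) →
          (∃ x₁, dist x₁ x₀ ≤ L ∧ V ≤ 2 * ‖u t x₁‖) → K * ν ≤ L * V → (T - t) * V ≤ K * L →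
          ∀ (v : ℝ → EuclideanSpace ℝ (Fin 3) → EuclideanSpace ℝ (Fin 3))
            (q : ℝ → EuclideanSpace ℝ (Fin 3) → ℝ) (Mv : ℝ),
            IsClassicalNSSolutionOn (Icc t T) ν 0 v q →
            (∀ s ∈ Icc t T, IsAxisymmetric (fun y : EuclideanSpace ℝ (Fin 3) => Q.symm (v s (x₀ + Q y)))) →
            (∀ s ∈ Icc t T, ∀ x, ‖v s x‖ ≤ Mv) →
            (∀ x ∈ ball x₀ (K * L), ‖u t x - v t x‖ ≤ A * V / K) →
            ∃ M : ℝ, ∀ s ∈ Ico t T, ∀ x ∈ ball x₀ (K * L / 2), ‖u s x‖ ≤ M) := by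
  constructor
  · intro h A hA
    obtain ⟨K₀, hK₀, hK⟩ := h A hA
    exact ⟨K₀, hK₀, hK K₀ le_rfl⟩
  · intro h A hA
    obtain ⟨K₀, hK₀, hK⟩ := h A hA
    exact ⟨K₀, hK₀, fun K hKK =>
      axisymShadowing_level_mono hA.le (lt_of_lt_of_le one_pos hK₀) hKK hK⟩

end CoreExclusionShadowing

end Summit.NavierStokesRegularity.NavierStokesRegularity.Theorems
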